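import Mathlib.MeasureTheory.Integral.IntervalIntegral.Basic
import Literature.Analysis.FunctionSpaces.FlatTorus
import Literature.Analysis.FunctionSpaces.TorusCalculus
import Literature.Analysis.FunctionSpaces.TorusTestFunction
import Literature.Analysis.FunctionSpaces.TorusSobolevNorm
import Literature.Analysis.FunctionSpaces.HolderNorm
import Literature.Analysis.FunctionSpaces.BesovDifference
import Literature.Analysis.FunctionSpaces.TorusFluidGlue
import HarnessLib

-- provenance: harness21/H21/H21/Statements/Turb/Onsager.lean @ 83d3230 (interim HEAD d8f2665); M5 mechanical rewrite
/-!
# Onsager's conjecture on `T³`: rigidity and flexibility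
(family: Turb, statements turb.S14, turb.S15, turb.S16, turb.S24; outline
`H21/Outlines/Sobolev.md` §3, item `TurbOnsager`)

Everything lives on the flat three-torus `T³ = UnitAddTorus (Fin 3)` (H21 `FlatTorus`, global
`volume`, a probability measure), velocity fields are `u : ℝ → T³ → EuclideanSpace ℝ (Fin 3)`
(time first).

## Contents

* **turb.S14** `Turb.IsWeakEulerSolution T u`: weak (distributional) solutions of incompressible
  Euler on `T³ × (0,T)` — an abbreviation of `Torus.IsWeakEulerSolutionOn` (Prelude
  `TorusFluidGlue`, De Lellis–Székelyhidi 2009 §1); the energy profile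
  `Turb.energyProfile u t = ½ ∫ ‖u t‖²` and energy conservation `Turb.ConservesEnergyOn`
  (everywhere-in-time) / `Turb.ConservesEnergyAEOn` (a.e.-in-time, the form provable for merely
  `L^∞_t L²_x` weak solutions).
* **turb.S24** the named function classes of the Onsager literature (Triebel 1983 §2.5.12; CCFS
  2008 §2), all abbreviations of Prelude `HolderNorm` / `BesovDifference` notions:
  `Turb.MemHolderClass α v` (`C^α(T³)`), `Turb.ContinuousInHolderClassOn S α u` (`C⁰_t C^α_x`),
  `Turb.MemL3tBesovSup T α u` (`L³_t B^α_{3,∞}`), `Turb.MemL3tBesovThirdSup T u`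
  (`L³_t B^{1/3}_{3,∞}`, the *sup* class), `Turb.MemL3tBesovThirdVanishing T u`
  (`L³_t B^{1/3}_{3,c₀}`, the CCFS *vanishing* class) and `Turb.MemBesovThirdVanishing v`
  (`B^{1/3}_{3,c₀}(T³)`).
* **turb.S15** Onsager rigidity: `Turb.onsager_rigidity` (Constantin–E–Titi 1994:
  `L³_t B^α_{3,∞}`, `α > 1/3` ⇒ energy conservation), `Turb.onsager_rigidity_ccfs`
  (Cheskidov–Constantin–Friedlander–Shvydkoy 2008 Thm 3.3: the sharp class `L³_t B^{1/3}_{3,c₀}`),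
  and the Hölder corollary `Turb.onsager_rigidity_holder` (`L³_t C^α_x`, `α > 1/3`).
* **turb.S16** Onsager flexibility: `Turb.onsager_flexibility` (Isett 2018 Thm 1;
  Buckmaster–De Lellis–Székelyhidi–Vicol 2019 Thm 1.1: for `α < 1/3` and any smooth positive
  energy profile there is a weak solution in `C^α(T³ × [0,T])` with that kinetic energy).

## Design choices

* No new analysis is defined here: every class is an `abbrev` of an accepted Prelude notion, so
  that all Prelude API applies by `Iff.rfl`/definitional unfolding. This file coexists with the
  accepted `Statements/Turb/Wave0.lean` (namespace `Literature.Turb`) and redefines nothing from it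
  (`Turb.kineticEnergy` there is character-for-character `Torus.kineticEnergy`, which we use).
* Energy conservation in the rigidity theorems is stated in the **a.e.-in-time** form
  `∀ᵐ s ∈ (0,T), ∀ᵐ t ∈ (0,T), E(u(s)) = E(u(t))`: a weak solution is only an `L²_{t,x}` class, so
  `t ↦ E(u(t))` is defined a.e.; CET/CCFS prove `E` is constant as a distribution on `(0,T)`,
  which for an `L¹_loc` function is exactly a.e. constancy. The everywhere version
  `ConservesEnergyOn` is recorded for continuous-in-time representatives and implies the a.e. one
  (`ConservesEnergyOn.conservesEnergyAEOn`, real proof).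
* Hölder exponents are `α : ℝ≥0` (Mathlib's `HolderWith`/`MemHolder` convention); Besov
  regularities are `α : ℝ` (Prelude `BesovDifference` convention).
* Flexibility is stated in the BDSV form with `HolderOnSpaceTime α T u`, i.e. `C^α` on
  `[0,T] × T³` for the product sup-metric (faithful to "`v ∈ C^β(T³ × [0,T])`"). The
  dense-admissible-data clause of the inventory text (Daneri–Székelyhidi 2017;
  Daneri–Runa–Székelyhidi 2021) needs the `L²`-solenoidal data space and admissibility, owned by
  T-FLUID; it is *not* stated here (outline: optional).
* No names with Greek letters spelled in ASCII (outline finding 7): `Third` for `1/3`.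

## Mathlib

Mathlib has Hölder functions (`HolderWith`, `MemHolder`, `eHolderNorm`,
`Mathlib/Topology/MetricSpace/HolderNorm.lean`) — used via Prelude `HolderNorm` — but no Besov
spaces, no Euler/Navier–Stokes notions and no Onsager statements (searched: `Besov`, `Onsager`,
`Euler` (fluid), `NavierStokes`, `kineticEnergy` — none). `UnitAddTorus`, `EuclideanSpace`,
`MeasureTheory.ae`, `Measure.restrict`, `ContDiffOn` are Mathlib's.

## References

* C. De Lellis, L. Székelyhidi Jr., *The Euler equations as a differential inclusion*, Ann. of
  Math. 170 (2009), §1.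
* P. Constantin, W. E, E. S. Titi, *Onsager's conjecture on the energy conservation for solutions
  of Euler's equation*, Comm. Math. Phys. 165 (1994), 207–209, Theorem.
* A. Cheskidov, P. Constantin, S. Friedlander, R. Shvydkoy, *Energy conservation and Onsager's
  conjecture for the Euler equations*, Nonlinearity 21 (2008) 1233–1252 = arXiv:0704.0759, §3.1
  (Def. 3.1, weak solutions), §3.2 (the class `B^{1/3}_{3,c(ℕ)}`) and Thm 3.3 (numbering of the
  arXiv version, the one held and checked).
* P. Isett, *A proof of Onsager's conjecture*, Ann. of Math. 188 (2018), Thm 1.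
* T. Buckmaster, C. De Lellis, L. Székelyhidi Jr., V. Vicol, *Onsager's conjecture for admissible
  weak solutions*, Comm. Pure Appl. Math. 72 (2019) 229–274 = arXiv:1701.08678, Thm 1.1.
* H. Triebel, *Theory of Function Spaces* (1983), §2.5.12.
-/

open MeasureTheory Set Filter Topology
open scoped NNReal ENNReal ContDiff

namespace Literature.Analysis.FluidPDE

section Turb

noncomputable section

/-- The flat three-torus `T³ = (ℝ/ℤ)³`, local notation. -/
local notation "𝕋³" => UnitAddTorus (Fin 3)

/-- Euclidean `ℝ³`, local notation. -/
local notation "ℝ³" => EuclideanSpace ℝ (Fin 3)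

/-! ## turb.S14: weak Euler solutions and the energy profile -/

section WeakEuler

/-- **turb.S14** (weak solutions of incompressible Euler on `T³ × (0,T)`; De Lellis–Székelyhidi,
Ann. Math. 170 (2009), §1). `u ∈ L²((0,T) × T³)` is weakly divergence free at a.e. time and
satisfies `∫₀ᵀ ∫ (⟪u, ∂ₜψ⟫ + ⟪u, (u·∇)ψ⟫) dx dt = 0` for every smooth divergence-free test field
`ψ` compactly supported in time in `(0,T)` (pressure-free distributional formulation). This is
the specialisation to `d = 3` of `Torus.IsWeakEulerSolutionOn` (= `Torus.IsWeakNSSolutionOn`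
with `ν = 0`). [folklore] -/
abbrev IsWeakEulerSolution (T : ℝ) (u : ℝ → 𝕋³ → ℝ³) : Prop :=
  FunctionSpaces.Torus.IsWeakEulerSolutionOn T u

/-- **turb.S14** (kinetic energy profile; De Lellis–Székelyhidi, Ann. Math. 170 (2009), §1).
`e(t) = E(u(t)) = ½ ∫_{T³} ‖u(t,x)‖² dx`, the kinetic energy of the time slice `u t`
(`Torus.kineticEnergy`, Bochner integral; junk value `0` at times where `u t ∉ L²`). [folklore] -/
abbrev energyProfile (u : ℝ → 𝕋³ → ℝ³) (t : ℝ) : ℝ :=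
  FunctionSpaces.Torus.kineticEnergy (u t)

/-- **turb.S14** (energy conservation on `(0,T)`, everywhere-in-time form; De Lellis–Székelyhidi,
Ann. Math. 170 (2009), §1). `E(u(s)) = E(u(t))` for all `s, t ∈ (0,T)`. Appropriate for
representatives that are continuous in time with values in `L²` (e.g. `C⁰_t C^α_x` solutions);
for general `L^∞_t L²_x` weak solutions use the a.e. version `ConservesEnergyAEOn`. [folklore] -/
def ConservesEnergyOn (T : ℝ) (u : ℝ → 𝕋³ → ℝ³) : Prop :=
  ∀ s ∈ Ioo 0 T, ∀ t ∈ Ioo 0 T, energyProfile u s = energyProfile u t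

/-- **turb.S14** (energy conservation on `(0,T)`, a.e.-in-time form; Constantin–E–Titi, CMP 165
(1994); CCFS, Nonlinearity 21 (2008), Thm 3.3). `E(u(s)) = E(u(t))` for a.e. `s ∈ (0,T)` and
a.e. `t ∈ (0,T)`, i.e. `t ↦ E(u(t))` is a.e. equal to a constant on `(0,T)` — the conclusion of
the rigidity theorems for weak solutions, which are only `L²_{t,x}` classes. [folklore] -/
def ConservesEnergyAEOn (T : ℝ) (u : ℝ → 𝕋³ → ℝ³) : Prop :=
  ∀ᵐ s ∂(volume.restrict (Ioo 0 T)), ∀ᵐ t ∂(volume.restrict (Ioo 0 T)),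
    energyProfile u s = energyProfile u t

variable {T : ℝ} {u : ℝ → 𝕋³ → ℝ³}

/-- Unfolding lemma: `IsWeakEulerSolution T u` is `Torus.IsWeakNSSolutionOn T 0 u`. [folklore] -/
theorem isWeakEulerSolution_iff :
    IsWeakEulerSolution T u ↔ FunctionSpaces.Torus.IsWeakNSSolutionOn T 0 u :=
  Iff.rfl

/-- The energy profile is nonnegative (`Torus.kineticEnergy_nonneg`). [folklore] -/
theorem energyProfile_nonneg (u : ℝ → 𝕋³ → ℝ³) (t : ℝ) : 0 ≤ energyProfile u t :=
  FunctionSpaces.Torus.kineticEnergy_nonneg (u t)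

/-- Everywhere-in-time energy conservation implies the a.e.-in-time version. [folklore] -/
theorem ConservesEnergyOn.conservesEnergyAEOn (h : ConservesEnergyOn T u) :
    ConservesEnergyAEOn T u := by
  filter_upwards [ae_restrict_mem (measurableSet_Ioo (a := (0 : ℝ)) (b := T))] with s hs
  filter_upwards [ae_restrict_mem (measurableSet_Ioo (a := (0 : ℝ)) (b := T))] with t ht
  exact h s hs t ht

/-- A.e. energy conservation is equivalent to `t ↦ E(u(t))` being a.e. equal to a constant on
`(0,T)`, provided `(0,T)` is nonempty. [folklore] -/
theorem conservesEnergyAEOn_iff_exists_ae_eq_const (hT : 0 < T) :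
    ConservesEnergyAEOn T u ↔
      ∃ c : ℝ, ∀ᵐ t ∂(volume.restrict (Ioo 0 T)), energyProfile u t = c := by
  constructor
  · intro h
    have hne : (volume.restrict (Ioo (0 : ℝ) T)) ≠ 0 := by
      rw [Ne, Measure.restrict_eq_zero, Real.volume_Ioo]
      simpa using hT
    haveI : (ae (volume.restrict (Ioo (0 : ℝ) T))).NeBot := ae_neBot.mpr hne
    obtain ⟨s, hs⟩ := h.exists
    exact ⟨energyProfile u s, hs.mono fun t ht => ht.symm⟩
  · rintro ⟨c, hc⟩
    filter_upwards [hc] with s hs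
    filter_upwards [hc] with t ht
    rw [hs, ht]

end WeakEuler

/-! ## turb.S24: the named Hölder / Besov classes on `T³` -/

section Classes

/-- **turb.S24** (the Hölder class `C^α(T³)`; Triebel, *Theory of Function Spaces* (1983),
§2.5.12; CCFS, Nonlinearity 21 (2008), §2). `v ∈ C^α(T³)`: `v` is bounded and `α`-Hölder for
the flat (quotient sup) metric of `T³`, i.e. `‖v‖_∞ + [v]_{C^{0,α}} < ∞`
(`Literature.Analysis.FunctionSpaces.MemBoundedHolder`). On the compact torus boundedness is automatic for `α`-Hölder maps
(`MemHolder.memBoundedHolder_of_compactSpace`). [folklore] -/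
abbrev MemHolderClass {F : Type*} [NormedAddCommGroup F] (α : ℝ≥0) (v : 𝕋³ → F) : Prop :=
  FunctionSpaces.MemBoundedHolder α v

/-- The class `C⁰_t C^α_x` on a time set `S` (turb.S24; De Lellis–Székelyhidi 2013 §2, CCFS
2008 §2): `u t ∈ C^α(T³)` for `t ∈ S` and `t ↦ u t` is continuous on `S` in the `C^α` norm
(`Literature.Analysis.FunctionSpaces.ContinuousInHolderOn`). [cite: LellisSzekelyhidi2013, §2  CCFS 2008 §2] -/
abbrev ContinuousInHolderClassOn {F : Type*} [NormedAddCommGroup F] (S : Set ℝ) (α : ℝ≥0)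
    (u : ℝ → 𝕋³ → F) : Prop :=
  FunctionSpaces.ContinuousInHolderOn S α u

/-- The class `L³_t B^α_{3,∞}` on `(0,T) × T³` (turb.S24; Constantin–E–Titi, CMP 165 (1994);
Triebel 1983 §2.5.12): `u t ∈ B^α_{3,∞}(T³)` for a.e. `t ∈ (0,T)` (Nikol'skii space via `L³`
difference quotients, `Literature.Analysis.FunctionSpaces.MemBesovSup`) and `t ↦ ‖u t‖_{B^α_{3,∞}}` is in `L³(0,T)`
(`Literature.MemLpBesovSup 3 α 3 u volume (Ioo 0 T)`). [cite: Triebel1983, §2.5.12] -/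
abbrev MemL3tBesovSup {F : Type*} [NormedAddCommGroup F] (T : ℝ) (α : ℝ) (u : ℝ → 𝕋³ → F) :
    Prop :=
  FunctionSpaces.MemLpBesovSup 3 α 3 u volume (Ioo 0 T)

/-- The Onsager-critical *sup* class `L³_t B^{1/3}_{3,∞}` on `(0,T) × T³` (turb.S24; CCFS,
Nonlinearity 21 (2008), §2): `MemL3tBesovSup T (1/3) u`. Energy conservation is **not** known
(and not expected) in this class; the sharp positive result uses the strictly smaller vanishing
class `MemL3tBesovThirdVanishing`. [folklore] -/
abbrev MemL3tBesovThirdSup {F : Type*} [NormedAddCommGroup F] (T : ℝ) (u : ℝ → 𝕋³ → F) :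
    Prop :=
  MemL3tBesovSup T (1 / 3) u

/-- The CCFS class `L³_t B^{1/3}_{3,c₀}` on `(0,T) × T³` (turb.S24; Cheskidov–Constantin–
Friedlander–Shvydkoy, Nonlinearity 21 (2008), §3.2 and Thm 3.3): `u t ∈ B^{1/3}_{3,c₀}(T³)` for
a.e. `t ∈ (0,T)` — the `L³` difference quotient `‖u t (· + h) - u t‖_{L³} / |h|^{1/3}` is
bounded *and tends to `0` as `h → 0`* — and `t ↦ ‖u t‖_{B^{1/3}_{3,∞}}` is in `L³(0,T)`
(`Literature.MemLpBesovSupVanishing 3 (1/3) 3 u volume (Ioo 0 T)`). [folklore] -/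
abbrev MemL3tBesovThirdVanishing {F : Type*} [NormedAddCommGroup F] (T : ℝ) (u : ℝ → 𝕋³ → F) :
    Prop :=
  FunctionSpaces.MemLpBesovSupVanishing 3 (1 / 3) 3 u volume (Ioo 0 T)

/-- The spatial CCFS class `B^{1/3}_{3,c₀}(T³)` (turb.S24; Cheskidov–Constantin–Friedlander–
Shvydkoy, Nonlinearity 21 (2008), §2): `v ∈ B^{1/3}_{3,∞}(T³)` with
`‖v(· + h) - v‖_{L³} / |h|^{1/3} → 0` as `h → 0` (`Literature.MemBesovSupVanishing (1/3) 3 v volume`). [folklore] -/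
abbrev MemBesovThirdVanishing {F : Type*} [NormedAddCommGroup F] (v : 𝕋³ → F) : Prop :=
  FunctionSpaces.MemBesovSupVanishing (1 / 3) 3 v volume

variable {F : Type*} [NormedAddCommGroup F] {T : ℝ} {α : ℝ} {u : ℝ → 𝕋³ → F}

/-- `L³_t B^{1/3}_{3,c₀} ⊂ L³_t B^{1/3}_{3,∞}` (CCFS 2008, §2). [cite: CCFS2008, §2] -/
theorem MemL3tBesovThirdVanishing.memL3tBesovThirdSup (hu : MemL3tBesovThirdVanishing T u) :
    MemL3tBesovThirdSup T u :=
  FunctionSpaces.MemLpBesovSupVanishing.memLpBesovSup hu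

/-- Fields in the CCFS class are in `B^{1/3}_{3,c₀}(T³)` at a.e. time of `(0,T)`. [folklore] -/
theorem MemL3tBesovThirdVanishing.ae_memBesovThirdVanishing
    (hu : MemL3tBesovThirdVanishing T u) :
    ∀ᵐ t ∂(volume.restrict (Ioo 0 T)), MemBesovThirdVanishing (u t) :=
  hu.1

/-- `L³_t B^α_{3,∞} ⊂ L³_t B^{1/3}_{3,c₀}` for `α > 1/3` on the (bounded) torus (CCFS 2008, §3.2,
p. 6: "the Besov spaces `B^{1/3}_{3,p}` for `1 ≤ p < ∞` ... are included in `B^{1/3}_{3,c(ℕ)}`" —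
this is how Thm 3.3 recovers Constantin–E–Titi): slice-wise
`MemBesovSup.memBesovSupVanishing_of_lt'` plus monotonicity of the Besov norm in the exponent on
a bounded group, i.e. `MemLpBesovSup.memLpBesovSupVanishing_of_lt`. Proved:
`MemL3tBesovSup.memL3tBesovThirdVanishing_holds`. [cite: CCFS2008, §3.2] -/
def MemL3tBesovSup.memL3tBesovThirdVanishing : Prop :=
  ∀ (hu : MemL3tBesovSup T α u) (hα : 1 / 3 < α),
    MemL3tBesovThirdVanishing T u

/-- Discharge of `MemL3tBesovSup.memL3tBesovThirdVanishing`: `L³_t B^α_{3,∞} ⊂ L³_t B^{1/3}_{3,c₀}`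
for `α > 1/3` on the torus, slice-wise `B^α_{3,∞}(T³) ⊂ B^{1/3}_{3,c₀}(T³)` (the torus is
bounded) with `‖·‖_{B^{1/3}_{3,∞}} ≤ C ‖·‖_{B^α_{3,∞}}` integrated in time
(`Literature.Analysis.FunctionSpaces.MemLpBesovSup.memLpBesovSupVanishing_of_lt`). This inclusion is how CCFS 2008 sharpen
the Constantin–E–Titi theorem (§1, p. 3: "we sharpen the result of [cet]"; §3.2, p. 6: "the
Besov spaces `B^{1/3}_{3,p}` for `1 ≤ p < ∞` ... are included in `B^{1/3}_{3,c(ℕ)}`").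
[cite: CCFS2008, §3.2] -/
theorem MemL3tBesovSup.memL3tBesovThirdVanishing_holds :
    MemL3tBesovSup.memL3tBesovThirdVanishing (T := T) (α := α) (u := u) :=
  fun hu hα => FunctionSpaces.MemLpBesovSup.memLpBesovSupVanishing_of_lt hu hα

/-- `L³_t C^α_x ⊂ L³_t B^α_{3,∞}` on `(0,T) × T³` for `0 < α` (CCFS 2008, §1–2; slice-wise
`MemBoundedHolder.memBesovSup` on the probability space `T³`, with `‖·‖_{B^α_{3,∞}} ≲ ‖·‖_{C^α}`). [cite: CCFS2008, §1–2] -/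
def _root_.Literature.Analysis.FunctionSpaces.MemLpHolder.memL3tBesovSup : Prop :=
  ∀ {α : ℝ≥0} (hu : FunctionSpaces.MemLpHolder 3 α u (Ioo 0 T)) (hα : 0 < α),
    MemL3tBesovSup T α u

/-- Discharge of `MemLpHolder.memL3tBesovSup`: `L³_t C^α_x ⊂ L³_t B^α_{3,∞}` on `(0,T) × T³` for
`0 < α`, from `Literature.Analysis.FunctionSpaces.MemLpHolder.memLpBesovSup` (slice-wise `C^α_b(T³) ⊂ B^α_{3,∞}(T³)` on the
probability space `T³` with `‖·‖_{B^α_{3,∞}} ≤ ‖·‖_{C^α}` integrated in time). [cite: CCFS2008, §1] -/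
theorem _root_.Literature.Analysis.FunctionSpaces.MemLpHolder.memL3tBesovSup_holds :
    FunctionSpaces.MemLpHolder.memL3tBesovSup (T := T) (u := u) :=
  fun hu hα => hu.memLpBesovSup hα 3

end Classes

/-! ## turb.S15: Onsager rigidity -/

section Rigidity

variable {T : ℝ} {u : ℝ → 𝕋³ → ℝ³}

/-- **turb.S15** (Onsager rigidity, Constantin–E–Titi, Comm. Math. Phys. 165 (1994), the
(unnumbered) Theorem on p. 207). A weak solution of incompressible Euler on `T³ × (0,T)` of class
`L³(0,T; B^α_{3,∞}(T³))` with `α > 1/3` conserves kinetic energy: `E(u(s)) = E(u(t))` for a.e.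
`s, t ∈ (0,T)` (`ConservesEnergyAEOn`, spelled out). Source check: CET work with "periodic
boundary conditions with period box `D = [0,1]³`" and state the Theorem for weak solutions
`u ∈ L³([0,T], B^{α,∞}_3(D)) ∩ C([0,T], L²(D))`, `α > 1/3`, concluding conservation of energy on
`[0,T]`; the present transcription drops the time-continuity hypothesis (a weak solution here is
an `L²_{t,x}` class, `IsWeakEulerSolution`) and accordingly concludes only a.e. in time, which is
what the commutator estimate of the proof yields (`E` is constant as a distribution on `(0,T)`;
cf. CCFS 2008, Thm 3.3, with `C_w([0,T]; L²)`). [cite: ConstantinETiti1994, Theorem p. 207] -/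
def onsager_rigidity : Prop :=
  ∀ {T : ℝ} {α : ℝ} (hα : 1 / 3 < α) (u : ℝ → 𝕋³ → ℝ³) (hu : IsWeakEulerSolution T u) (hB : MemL3tBesovSup T α u),
    ∀ᵐ s ∂(volume.restrict (Ioo 0 T)), ∀ᵐ t ∂(volume.restrict (Ioo 0 T)),
      energyProfile u s = energyProfile u t

/-- **turb.S15** (sharp Onsager rigidity, Cheskidov–Constantin–Friedlander–Shvydkoy,
Nonlinearity 21 (2008), Thm 3.3 in the numbering of arXiv:0704.0759). A weak solution of
incompressible Euler on `T³ × (0,T)` of class `L³(0,T; B^{1/3}_{3,c₀}(T³))` — the *vanishing*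
class `MemL3tBesovThirdVanishing`, not merely `L³_t B^{1/3}_{3,∞}` — conserves kinetic energy:
`E(u(s)) = E(u(t))` for a.e. `s, t ∈ (0,T)`. Source check: Thm 3.3 reads "The total energy flux
of any divergence-free vector field in the class `B^{1/3}_{3,c(ℕ)} ∩ L²` vanishes. In
particular, every weak solution to the Euler equation that belongs to the class
`L³([0,T]; B^{1/3}_{3,c(ℕ)}) ∩ C_w([0,T]; L²)` conserves energy", stated on `ℝ³` (Def. 3.1:
`u ∈ C_w([0,T]; L²(ℝ^d))`, Schwartz divergence-free test fields) for the Littlewood–Paley class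
`B^{1/3}_{3,c(ℕ)} = {u : lim_q λ_q^{1/3} ‖Δ_q u‖₃ = 0}` (§3.2, p. 6), which contains the
difference-quotient class `B^{1/3}_{3,c₀}` used here; the present transcription is to the
periodic box, `L²_{t,x}` weak solutions and a.e. times. [cite: CCFS2008, Thm 3.3 (arXiv:0704.0759 numbering)] -/
def onsager_rigidity_ccfs : Prop :=
  ∀ {T : ℝ} (u : ℝ → 𝕋³ → ℝ³) (hu : IsWeakEulerSolution T u) (hB : MemL3tBesovThirdVanishing T u),
    ∀ᵐ s ∂(volume.restrict (Ioo 0 T)), ∀ᵐ t ∂(volume.restrict (Ioo 0 T)),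
      energyProfile u s = energyProfile u t

/-- The Constantin–E–Titi form `onsager_rigidity` is formally a corollary of the sharp CCFS form
`onsager_rigidity_ccfs` through the class inclusion `L³_t B^α_{3,∞} ⊂ L³_t B^{1/3}_{3,c₀}`,
`α > 1/3` (`MemL3tBesovSup.memL3tBesovThirdVanishing_holds`), as CCFS 2008 note in §1, p. 3
("we sharpen the result of [cet]") and §3.2, p. 6. [cite: CCFS2008, §3.2] -/
theorem onsager_rigidity_of_ccfs (h : onsager_rigidity_ccfs) : onsager_rigidity :=
  fun hα u hu hB => h u hu (MemL3tBesovSup.memL3tBesovThirdVanishing_holds hB hα)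

/-- **turb.S15** (Onsager rigidity, Hölder form; Constantin–E–Titi 1994, Cor. of the Theorem via
`C^α ⊂ B^α_{3,∞}`; CCFS 2008, §1). A weak Euler solution on `T³ × (0,T)` of class
`L³(0,T; C^α(T³))` with `α > 1/3` conserves kinetic energy (a.e. in time). In particular this
covers `u ∈ C⁰_t C^α_x` and `u ∈ L^∞_t C^α_x`. CET, p. 207, right after the Theorem: "Onsager
stated his conjecture in Hölder spaces rather than Besov spaces. Obviously the above theorem
implies similar results in Hölder spaces." Reduction to `onsager_rigidity`:
`onsager_rigidity_holder_of`. [cite: ConstantinETiti1994, Theorem p. 207 and the remark following it] -/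
def onsager_rigidity_holder : Prop :=
  ∀ {T : ℝ} {α : ℝ≥0} (hα : 1 / 3 < α) (u : ℝ → 𝕋³ → ℝ³) (hu : IsWeakEulerSolution T u) (hH : FunctionSpaces.MemLpHolder 3 α u (Ioo 0 T)),
    ∀ᵐ s ∂(volume.restrict (Ioo 0 T)), ∀ᵐ t ∂(volume.restrict (Ioo 0 T)),
      energyProfile u s = energyProfile u t

/- interim proof relied on results that are now named facts (D-0014); demoted to a fact by the M5 import, proof preserved:
:= by
  refine onsager_rigidity (α := (α : ℝ)) ?_ u hu (hH.memL3tBesovSup ?_)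
  · have : ((1 / 3 : ℝ≥0) : ℝ) < α := NNReal.coe_lt_coe.mpr hα
    simpa using this
  · exact lt_trans (by positivity) hα
-/

/-- The Hölder form `onsager_rigidity_holder` follows from the Besov form `onsager_rigidity` and
the class inclusion `L³_t C^α_x ⊂ L³_t B^α_{3,∞}` on `T³` (`MemLpHolder.memL3tBesovSup`, taken as
a hypothesis), exactly as CET remark on p. 207 (the interim proof, restored). [folklore] -/
theorem onsager_rigidity_holder_of (h : onsager_rigidity)
    (hHB : ∀ {T : ℝ} {u : ℝ → 𝕋³ → ℝ³}, FunctionSpaces.MemLpHolder.memL3tBesovSup (T := T) (u := u)) :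
    onsager_rigidity_holder := by
  intro T α hα u hu hH
  refine h (α := (α : ℝ)) ?_ u hu (hHB hH ?_)
  · have : ((1 / 3 : ℝ≥0) : ℝ) < α := NNReal.coe_lt_coe.mpr hα
    simpa using this
  · exact lt_trans (by positivity) hα

/-- The Hölder form of Onsager rigidity reduces to the Besov form `onsager_rigidity` alone
(`onsager_rigidity_holder_of` with `MemLpHolder.memL3tBesovSup_holds`). [folklore] -/
theorem onsager_rigidity_holder_of' (h : onsager_rigidity) : onsager_rigidity_holder :=
  onsager_rigidity_holder_of h FunctionSpaces.MemLpHolder.memL3tBesovSup_holds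

/-- The conclusion of the rigidity theorems is `ConservesEnergyAEOn` (by definition). [folklore] -/
def conservesEnergyAEOn_of_memL3tBesovThirdVanishing : Prop :=
  ∀ (hu : IsWeakEulerSolution T u) (hB : MemL3tBesovThirdVanishing T u),
    ConservesEnergyAEOn T u

/- interim proof relied on results that are now named facts (D-0014); demoted to a fact by the M5 import, proof preserved:
:=
  onsager_rigidity_ccfs u hu hB
-/

/-- `conservesEnergyAEOn_of_memL3tBesovThirdVanishing` is `onsager_rigidity_ccfs` read through
the definition of `ConservesEnergyAEOn` (the interim proof, restored with the fact as a
hypothesis). [folklore] -/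
theorem conservesEnergyAEOn_of_memL3tBesovThirdVanishing_of (h : onsager_rigidity_ccfs) :
    conservesEnergyAEOn_of_memL3tBesovThirdVanishing (T := T) (u := u) :=
  fun hu hB => h u hu hB

end Rigidity

/-! ## turb.S16: Onsager flexibility -/

section Flexibility

/-- **turb.S16** (Onsager flexibility; Isett, Ann. Math. 188 (2018), Thm 1; Buckmaster–De Lellis–
Székelyhidi–Vicol, Comm. Pure Appl. Math. 72 (2019), Thm 1.1, whose form is stated). For every
`α < 1/3`, every `T > 0` and every smooth strictly positive energy profile `e : [0,T] → ℝ` there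
is a weak solution `u` of incompressible Euler on `T³ × (0,T)` with `u ∈ C^α(T³ × [0,T])`
(Hölder for the product sup-metric, `Literature.Analysis.FunctionSpaces.HolderOnSpaceTime`) and `½ ∫_{T³} ‖u(t,x)‖² dx = e(t)`
for all `t ∈ [0,T]`. In particular (taking `e` strictly decreasing) there are dissipative Hölder
continuous Euler flows below the Onsager exponent (Isett's Thm 1). "Smooth" is
`ContDiffOn ℝ ∞ e (Icc 0 T)` (BDSV Thm 1.1: "Assume `e : [0,T] → ℝ` is a strictly positive
smooth function. Then for any `0 < β < 1/3` there exists a weak solution `v ∈ C^β(T³ × [0,T])`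
... such that `∫_{T³} |v(x,t)|² dx = e(t)`"; apply it to `2e` for the factor `½`, and to some
`β ∈ (α, 1/3)`, `β > 0`, for `α = 0`). [cite: BuckmasterEtAl2018, Thm 1.1] -/
def onsager_flexibility : Prop :=
  ∀ {α : ℝ≥0} (hα : α < 1 / 3) {T : ℝ} (hT : 0 < T) (e : ℝ → ℝ) (he : ContDiffOn ℝ ∞ e (Icc 0 T)) (hpos : ∀ t ∈ Icc 0 T, 0 < e t),
    ∃ u : ℝ → 𝕋³ → ℝ³, IsWeakEulerSolution T u ∧ FunctionSpaces.HolderOnSpaceTime α T u ∧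
      ∀ t ∈ Icc 0 T, energyProfile u t = e t

/-- **turb.S16** (Onsager flexibility, dissipative form; Isett, Ann. Math. 188 (2018), Thm 1).
For every `α < 1/3` and `T > 0` there is a nonzero weak solution of incompressible Euler on
`T³ × (0,T)` in `C^α(T³ × [0,T])` whose kinetic energy is strictly decreasing on `[0,T]`
(hence it does not conserve energy). Immediate from `onsager_flexibility` with a strictly
decreasing smooth positive profile. [folklore] -/
def onsager_flexibility_strictAntiOn : Prop :=
  ∀ {α : ℝ≥0} (hα : α < 1 / 3) {T : ℝ} (hT : 0 < T),
    ∃ u : ℝ → 𝕋³ → ℝ³, IsWeakEulerSolution T u ∧ FunctionSpaces.HolderOnSpaceTime α T u ∧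
      StrictAntiOn (energyProfile u) (Icc 0 T)

/- interim proof relied on results that are now named facts (D-0014); demoted to a fact by the M5 import, proof preserved:
:= by
  obtain ⟨u, hu, hH, he⟩ :=
    onsager_flexibility hα hT (fun t => T + 1 - t) (by fun_prop) fun t ht => by
      simp only [mem_Icc] at ht
      linarith
  refine ⟨u, hu, hH, fun s hs t ht hst => ?_⟩
  rw [he s hs, he t ht]
  linarith
-/

/-- The dissipative form `onsager_flexibility_strictAntiOn` follows from `onsager_flexibility`
with the strictly decreasing smooth positive profile `e(t) = T + 1 - t` (the interim proof,
restored with the fact as a hypothesis). [folklore] -/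
theorem onsager_flexibility_strictAntiOn_of (h : onsager_flexibility) :
    onsager_flexibility_strictAntiOn := by
  intro α hα T hT
  obtain ⟨u, hu, hH, he⟩ :=
    h hα hT (fun t => T + 1 - t) (by fun_prop) fun t ht => by
      simp only [mem_Icc] at ht
      linarith
  refine ⟨u, hu, hH, fun s hs t ht hst => ?_⟩
  rw [he s hs, he t ht]
  linarith

end Flexibility

end

end Turb

end Literature.Analysis.FluidPDE
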